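import Summits.AtomisticToContinuum.BoseEinsteinCondensation.Theorems.BECCutLineWeakDisorderGroundStateRigidityReduction
import Literature.Analysis.Calculus.PolarCoordinatesE3
import HarnessLib

/-!
# Crux `GroundStateRigidity` (stmt-AtomisticToContinuum-9072), line `Sketch`: the energy functional — hence
# rigidity — ignores the values of `v` on a Lebesgue-null set of radii; the crux for ESSENTIALLY bounded `v`

Route `BECCutLineWeakDisorder` (decl shared verbatim by 8 routes).  Lead c1 of line `Sketch`, 2026-08-16.

The open kernel of the crux (`stub_uniquenessKernel`) concerns UNBOUNDED admissible `v`.  This file records,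
sorry-free, that only ESSENTIAL unboundedness on `(0, ∞)` matters: the variational energy
`energy v Ψ = ∫ (|∇Ψ|² + Σ_{i<j} v(|xᵢ−xⱼ|)|Ψ|²)` of every trial state, hence `groundStateEnergy v N L` and the
rigidity statement at `(v, N, L)`, are unchanged when `v` is modified on a Lebesgue-null set of radii `S ⊂ ℝ`
(the value at `r = 0` included: the collision planes `{xᵢ = xⱼ}` are null).  Mechanism: for `i ≠ j` the set
`{X : |xᵢ − xⱼ| ∈ S}` is Lebesgue-null in `(ℝ³)^N` — a volume-preserving shear `xᵢ ↦ xᵢ − xⱼ` reduces it to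
`{X : |xᵢ| ∈ S}`, a coordinate preimage of the radially-null set `{z : |z| ∈ S}` (polar coordinates,
`Literature.Analysis.Calculus.lintegral_radial_eq`).  Consequence (`groundStateRigidity_of_essBounded`): the
conclusion of the crux holds at EVERY density for every measurable `v` that is bounded off a null set of radii
(e.g. `v(0) = ⊤`, or `⊤` on a null set), by `groundStateRigidity_of_bounded` applied to `v ⊓ C`.
-/

noncomputable section

open MeasureTheory Filter Metric Set
open scoped ENNReal NNReal Topology

namespace Summit.AtomisticToContinuum.BoseEinsteinCondensation.Theorems.GroundStateRigidity

open Literature.MathematicalPhysics.QuantumManyBody.BoseGas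

/-! ### Null sets of radii are invisible to the configuration measure -/

/-- **Radially null sets are null in `ℝ³`**: if `S ⊂ ℝ` is measurable and Lebesgue-null then
`{z : ℝ³ | ‖z‖ ∈ S}` is Lebesgue-null (polar coordinates: its measure is `σ(S²) ∫_{S ∩ (0,∞)} r² dr`). -/
theorem volume_setOf_norm_mem_eq_zero {S : Set ℝ} (hS : MeasurableSet S) (h0 : volume S = 0) :
    volume {z : Space | ‖z‖ ∈ S} = 0 := by
  have hmeas : MeasurableSet {z : Space | ‖z‖ ∈ S} := measurable_norm hS
  rw [← lintegral_indicator_one hmeas]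
  have hind : (fun z : Space => ({z : Space | ‖z‖ ∈ S}).indicator (1 : Space → ℝ≥0∞) z) =
      fun z : Space => S.indicator (1 : ℝ → ℝ≥0∞) ‖z‖ := by
    funext z
    by_cases hz : ‖z‖ ∈ S
    · rw [indicator_of_mem (show z ∈ {z : Space | ‖z‖ ∈ S} from hz), indicator_of_mem hz]
      rfl
    · rw [indicator_of_notMem (show z ∉ {z : Space | ‖z‖ ∈ S} from hz), indicator_of_notMem hz]
  rw [hind, Literature.Analysis.Calculus.lintegral_radial_eq (S.indicator 1)
    ((measurable_one.indicator hS))]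
  have hint : ∫⁻ r in Ioi (0 : ℝ), S.indicator (1 : ℝ → ℝ≥0∞) r * ENNReal.ofReal (r ^ 2) = 0 := by
    refine (lintegral_eq_zero_iff' ?_).2 ?_
    · exact (((measurable_one.indicator hS)).mul (by fun_prop)).aemeasurable
    · have hae : ∀ᵐ r ∂(volume.restrict (Ioi (0 : ℝ))), r ∉ S := by
        rw [ae_restrict_iff' measurableSet_Ioi]
        have : ∀ᵐ r ∂(volume : Measure ℝ), r ∉ S := measure_eq_zero_iff_ae_notMem.1 h0
        exact this.mono fun r hr _ => hr
      filter_upwards [hae] with r hr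
      simp [indicator_of_notMem hr]
  rw [hint, mul_zero]

variable {N : ℕ}

/-- The nilpotent part of the shear: `X ↦ (0, …, 0, xⱼ, 0, …, 0)` (the `j`-th coordinate put in slot `i`). -/
def shearPart (i j : Fin N) : Config N →ₗ[ℝ] Config N :=
  (LinearMap.single ℝ (fun _ : Fin N => Space) i).comp (LinearMap.proj j)

/-- Coordinates of `shearPart`. -/
theorem shearPart_apply (i j : Fin N) (X : Config N) :
    shearPart i j X = Pi.single i (X j) := rfl

/-- For `i ≠ j` the nilpotent part squares to zero. -/
theorem shearPart_comp_self {i j : Fin N} (hij : i ≠ j) :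
    (shearPart i j).comp (shearPart i j) = 0 := by
  ext X k l
  simp [shearPart_apply, Pi.single_apply, hij.symm]

/-- **The shear `xᵢ ↦ xᵢ − xⱼ`** (other coordinates fixed), a linear automorphism of `(ℝ³)^N` for `i ≠ j`
(inverse `xᵢ ↦ xᵢ + xⱼ`). -/
def shear {i j : Fin N} (hij : i ≠ j) : Config N ≃ₗ[ℝ] Config N :=
  LinearEquiv.ofLinear (LinearMap.id - shearPart i j) (LinearMap.id + shearPart i j)
    (by
      rw [LinearMap.sub_comp, LinearMap.comp_add, LinearMap.comp_add, LinearMap.id_comp,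
        LinearMap.id_comp, LinearMap.comp_id, shearPart_comp_self hij]
      abel)
    (by
      rw [LinearMap.add_comp, LinearMap.comp_sub, LinearMap.comp_sub, LinearMap.id_comp,
        LinearMap.id_comp, LinearMap.comp_id, shearPart_comp_self hij]
      abel)

/-- The `i`-th coordinate of the sheared configuration is `xᵢ − xⱼ`. -/
theorem shear_apply_self {i j : Fin N} (hij : i ≠ j) (X : Config N) :
    shear hij X i = X i - X j := by
  simp [shear, shearPart_apply]

/-- **Null pair-distance sets**: for `i ≠ j` and a measurable Lebesgue-null `S ⊂ ℝ`, the set of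
configurations with `|xᵢ − xⱼ| ∈ S` is Lebesgue-null in `(ℝ³)^N`. -/
theorem volume_setOf_dist_mem_eq_zero {i j : Fin N} (hij : i ≠ j) {S : Set ℝ} (hS : MeasurableSet S)
    (h0 : volume S = 0) : volume {X : Config N | dist (X i) (X j) ∈ S} = 0 := by
  set A : Set Space := {z | ‖z‖ ∈ S} with hA
  have hAm : MeasurableSet A := measurable_norm hS
  have hA0 : volume A = 0 := volume_setOf_norm_mem_eq_zero hS h0
  -- the coordinate preimage `{X | X i ∈ A}` is null
  have hB0 : volume (Function.eval i ⁻¹' A : Set (Config N)) = 0 := by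
    rw [volume_pi]
    exact Measure.pi_eval_preimage_null _ hA0
  -- the set is the preimage of `{X | X i ∈ A}` under the volume-scaling linear shear
  have hset : {X : Config N | dist (X i) (X j) ∈ S} = (shear hij) ⁻¹' (Function.eval i ⁻¹' A) := by
    ext X
    simp only [mem_setOf_eq, mem_preimage, Function.eval, hA]
    rw [show ((shear hij) X) i = X i - X j from shear_apply_self hij X, dist_eq_norm]
  have hdet : LinearMap.det ((shear hij : Config N ≃ₗ[ℝ] Config N) : Config N →ₗ[ℝ] Config N) ≠ 0 :=
    (LinearEquiv.isUnit_det' (shear hij)).ne_zero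
  have hmap := Measure.map_linearMap_addHaar_eq_smul_addHaar (μ := (volume : Measure (Config N))) hdet
  have hmeasB : MeasurableSet (Function.eval i ⁻¹' A : Set (Config N)) := measurable_pi_apply i hAm
  have hmeasφ : Measurable
      ((shear hij : Config N ≃ₗ[ℝ] Config N) : Config N →ₗ[ℝ] Config N) :=
    (LinearMap.continuous_of_finiteDimensional _).measurable
  have key : (Measure.map ((shear hij : Config N ≃ₗ[ℝ] Config N) : Config N →ₗ[ℝ] Config N) volume)
      (Function.eval i ⁻¹' A) = 0 := by
    rw [hmap, Measure.smul_apply, hB0, smul_zero]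
  rw [Measure.map_apply hmeasφ hmeasB] at key
  rw [hset]
  simpa only [LinearEquiv.coe_coe] using key

/-! ### Modifying `v` on a null set of radii changes nothing -/

/-- **The interaction ignores null sets of radii**: if `v = v'` off a measurable Lebesgue-null set of radii,
then `Σ_{i<j} v(|xᵢ−xⱼ|) = Σ_{i<j} v'(|xᵢ−xⱼ|)` for a.e. configuration. -/
theorem interaction_ae_eq {v v' : ℝ → ℝ≥0∞} {S : Set ℝ} (hS : MeasurableSet S) (h0 : volume S = 0)
    (h : ∀ r, r ∉ S → v r = v' r) :
    ∀ᵐ X : Config N, interaction v X = interaction v' X := by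
  have hnull : volume (⋃ i : Fin N, ⋃ j : Fin N, ⋃ (_ : i ≠ j),
      {X : Config N | dist (X i) (X j) ∈ S}) = 0 := by
    refine measure_iUnion_null fun i => measure_iUnion_null fun j => measure_iUnion_null fun hij => ?_
    exact volume_setOf_dist_mem_eq_zero hij hS h0
  have hae : ∀ᵐ X : Config N, X ∉ ⋃ i : Fin N, ⋃ j : Fin N, ⋃ (_ : i ≠ j),
      {X : Config N | dist (X i) (X j) ∈ S} := measure_eq_zero_iff_ae_notMem.1 hnull
  filter_upwards [hae] with X hX
  simp only [mem_iUnion, mem_setOf_eq, not_exists] at hX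
  unfold interaction
  refine Finset.sum_congr rfl fun i _ => Finset.sum_congr rfl fun j hj => ?_
  have hij : i ≠ j := (Finset.mem_filter.1 hj).2.ne
  exact h _ (hX i j hij)

/-- **The energy ignores null sets of radii**: `energy v Ψ = energy v' Ψ` for every trial state when
`v = v'` off a measurable null set of radii. -/
theorem energy_congr_offNull {v v' : ℝ → ℝ≥0∞} {S : Set ℝ} (hS : MeasurableSet S) (h0 : volume S = 0)
    (h : ∀ r, r ∉ S → v r = v' r) {L : ℝ} (Ψ : TrialState N L) : energy v Ψ = energy v' Ψ := by
  unfold energy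
  refine lintegral_congr_ae ?_
  filter_upwards [interaction_ae_eq (N := N) hS h0 h] with X hX
  rw [hX]

/-- **The ground-state energy ignores null sets of radii.** -/
theorem groundStateEnergy_congr_offNull {v v' : ℝ → ℝ≥0∞} {S : Set ℝ} (hS : MeasurableSet S)
    (h0 : volume S = 0) (h : ∀ r, r ∉ S → v r = v' r) (N : ℕ) (L : ℝ) :
    groundStateEnergy v N L = groundStateEnergy v' N L := by
  unfold groundStateEnergy
  exact iInf_congr fun Ψ => energy_congr_offNull hS h0 h Ψ

/-- **Rigidity ignores null sets of radii**: the rigidity statement at `(v, N, L)` transfers from `v'` to `v`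
when `v = v'` off a measurable null set of radii (both sides only involve `energy` and `groundStateEnergy`). -/
theorem rigid_congr_offNull {v v' : ℝ → ℝ≥0∞} {S : Set ℝ} (hS : MeasurableSet S) (h0 : volume S = 0)
    (h : ∀ r, r ∉ S → v r = v' r) {N : ℕ} {L : ℝ}
    (hR : ∀ η : ℝ, 0 < η → ∃ δ : ℝ≥0∞, 0 < δ ∧ ∀ Ψ Φ : TrialState N L,
        energy v' Ψ ≤ groundStateEnergy v' N L + δ → energy v' Φ ≤ groundStateEnergy v' N L + δ →
        ∃ c : ℂ, ‖c‖ = 1 ∧ ∫⁻ X, (‖Ψ.ψ X - c * Φ.ψ X‖₊ : ℝ≥0∞) ^ 2 ≤ ENNReal.ofReal η) :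
    ∀ η : ℝ, 0 < η → ∃ δ : ℝ≥0∞, 0 < δ ∧ ∀ Ψ Φ : TrialState N L,
        energy v Ψ ≤ groundStateEnergy v N L + δ → energy v Φ ≤ groundStateEnergy v N L + δ →
        ∃ c : ℂ, ‖c‖ = 1 ∧ ∫⁻ X, (‖Ψ.ψ X - c * Φ.ψ X‖₊ : ℝ≥0∞) ^ 2 ≤ ENNReal.ofReal η := by
  intro η hη
  obtain ⟨δ, hδ, hΨΦ⟩ := hR η hη
  refine ⟨δ, hδ, fun Ψ Φ hΨ hΦ => hΨΦ Ψ Φ ?_ ?_⟩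
  · rwa [← energy_congr_offNull hS h0 h Ψ, ← groundStateEnergy_congr_offNull hS h0 h N L]
  · rwa [← energy_congr_offNull hS h0 h Φ, ← groundStateEnergy_congr_offNull hS h0 h N L]

/-- **The closed energy ignores null sets of radii** (it is an infimum of `liminf`s of energies of trial
states). -/
theorem closedEnergy_congr_offNull {v v' : ℝ → ℝ≥0∞} {S : Set ℝ} (hS : MeasurableSet S)
    (h0 : volume S = 0) (h : ∀ r, r ∉ S → v r = v' r) (L : ℝ) (Ψ : Config N → ℂ) :
    closedEnergy v L Ψ = closedEnergy v' L Ψ := by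
  unfold closedEnergy
  refine iInf_congr fun Φ => iInf_congr fun _ => ?_
  congr 1
  funext n
  exact energy_congr_offNull hS h0 h (Φ n)

/-- **Ground states ignore null sets of radii**: `IsGroundState v L Ψ ↔ IsGroundState v' L Ψ`. -/
theorem isGroundState_iff_offNull {v v' : ℝ → ℝ≥0∞} {S : Set ℝ} (hS : MeasurableSet S)
    (h0 : volume S = 0) (h : ∀ r, r ∉ S → v r = v' r) {L : ℝ} {Ψ : Config N → ℂ} :
    IsGroundState v L Ψ ↔ IsGroundState v' L Ψ := by
  constructor
  · intro hΨ
    refine ⟨hΨ.measurable, hΨ.eq_zero, hΨ.symm, ?_, ?_⟩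
    · rw [← closedEnergy_congr_offNull hS h0 h L Ψ]; exact hΨ.closedEnergy_ne_top
    · rw [← closedEnergy_congr_offNull hS h0 h L Ψ, ← groundStateEnergy_congr_offNull hS h0 h N L]
      exact hΨ.closedEnergy_eq
  · intro hΨ
    have h' : ∀ r, r ∉ S → v' r = v r := fun r hr => (h r hr).symm
    refine ⟨hΨ.measurable, hΨ.eq_zero, hΨ.symm, ?_, ?_⟩
    · rw [← closedEnergy_congr_offNull hS h0 h' L Ψ]; exact hΨ.closedEnergy_ne_top
    · rw [← closedEnergy_congr_offNull hS h0 h' L Ψ, ← groundStateEnergy_congr_offNull hS h0 h' N L]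
      exact hΨ.closedEnergy_eq

/-- **Nondegeneracy ignores null sets of radii**: `HasUniqueGroundState v N L ↔ HasUniqueGroundState v' N L`.
So the uniqueness kernel of the crux only concerns the ESSENTIAL behaviour of `v` on `(0, ∞)`. -/
theorem hasUniqueGroundState_iff_offNull {v v' : ℝ → ℝ≥0∞} {S : Set ℝ} (hS : MeasurableSet S)
    (h0 : volume S = 0) (h : ∀ r, r ∉ S → v r = v' r) {L : ℝ} :
    HasUniqueGroundState v N L ↔ HasUniqueGroundState v' N L := by
  unfold HasUniqueGroundState
  simp only [isGroundState_iff_offNull (N := N) hS h0 h]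

/-! ### The crux for essentially bounded potentials, at every density -/

/-- **`GroundStateRigidity` for ESSENTIALLY bounded potentials — at every density.**  If `v` is measurable
and essentially bounded (`v ≤ C` for a.e. radius; e.g. `v(0) = ⊤`, or `v = ⊤` on a null set of radii),
then for every `ρ > 0`, all `N ≥ 1` and every `η > 0` some `δ > 0` makes any two `δ`-near-minimisers in the box
of side `(N/ρ)^{1/3}` `η`-close in `L²` up to a phase: the truncation `v ⊓ C` is bounded measurable and agrees
with `v` off the null set, so `groundStateRigidity_of_bounded` transfers verbatim (`rigid_congr_offNull`).
So the open kernel of the crux is about ESSENTIAL unboundedness on `(0, ∞)` only.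
[cite: ReedSimonIV1978, §XIII.12 Thm XIII.47] -/
theorem groundStateRigidity_of_essBounded :
    ∀ v : ℝ → ℝ≥0∞, Measurable v → (∃ C : ℝ≥0, ∀ᵐ r : ℝ, v r ≤ C) →
      ∀ ρ : ℝ, 0 < ρ → ∀ᶠ N : ℕ in atTop, ∀ η : ℝ, 0 < η → ∃ δ : ℝ≥0∞, 0 < δ ∧
        ∀ Ψ Φ : TrialState N (sideLength ρ N),
          energy v Ψ ≤ groundStateEnergy v N (sideLength ρ N) + δ →
          energy v Φ ≤ groundStateEnergy v N (sideLength ρ N) + δ →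
          ∃ c : ℂ, ‖c‖ = 1 ∧ ∫⁻ X, (‖Ψ.ψ X - c * Φ.ψ X‖₊ : ℝ≥0∞) ^ 2 ≤ ENNReal.ofReal η := by
  intro v hv hb ρ hρ
  obtain ⟨C, hCae⟩ := hb
  -- the exceptional null set of radii
  set S : Set ℝ := {r | (C : ℝ≥0∞) < v r} with hSdef
  have hS : MeasurableSet S := measurableSet_lt measurable_const hv
  have h0 : volume S = 0 := by
    rw [measure_eq_zero_iff_ae_notMem]
    filter_upwards [hCae] with r hr
    simpa [hSdef] using hr
  have hC : ∀ r, r ∉ S → v r ≤ C := fun r hr => not_lt.1 (by simpa [hSdef] using hr)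
  -- the bounded truncation
  set v' : ℝ → ℝ≥0∞ := fun r => min (v r) C with hv'
  have hv'm : Measurable v' := hv.min measurable_const
  have hv'C : ∀ r, v' r ≤ C := fun r => min_le_right _ _
  have hvv' : ∀ r, r ∉ S → v r = v' r := fun r hr => (min_eq_left (hC r hr)).symm
  filter_upwards [groundStateRigidity_of_bounded v' hv'm ⟨C, hv'C⟩ ρ hρ] with N hN
  exact rigid_congr_offNull hS h0 hvv' hN

end Summit.AtomisticToContinuum.BoseEinsteinCondensation.Theorems.GroundStateRigidity

end
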